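import Literature.NumberTheory.LFunctions.ZetaZerosShortIntervalsRH
import Literature.NumberTheory.LFunctions.PrimeSumInvSqrt
import HarnessLib

/-!
# Goldston–Gonek: zeros of `ζ` in short intervals under RH (Balazard–de Roton 2008, Prop. 16)

Topic `Literature/NumberTheory/LFunctions`. Everything in this file is PROVED (no definitions, no
named facts).

M. Balazard, A. de Roton, *Notes de lecture…*, arXiv:0810.3587, Prop. 16 (= D. A. Goldston,
S. M. Gonek, Bull. LMS 39 (2007), the upper half of the main theorem):

> **Proposition 16 (HR).** Pour `t` assez grand et `0 < h ≤ √t` on a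
> `|N(t+h) − N(t−h) − (h/π) log(t/2π)| ≤ log t/(2 log log t) + (1/2 + o(1)) log t · log log log t/(log log t)²`.

We prove the UPPER bound for `0 < h ≤ 1` (the case used in Props. 17–18 of the paper):
`Literature.NumberTheory.LFunctions.zetaZeroCount_short_interval_GG_of_RH`: for every `ε > 0`, for
`t ≥ T₀(ε)` and `0 < h ≤ 1`,
`N(t+h) − N(t−h) − (h/π) log(t/2π) ≤ log t/(2 log log t) + (1/2 + ε) log t · log log log t/(log log t)²`.

Proof (as printed): Prop. 15 (`ShortIntervalsRH.zetaZeroCount_short_interval_le_of_RH`) with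
`Δ = (1/π) log(log t/log log t)`, the Dirichlet polynomial bounded trivially through
`|(log p/π) F̂₊(log p/2π)| ≤ 4` and Chebyshev's `Σ_{p ≤ X} p^{-1/2} ≪ √X/log X`
(`Literature.NumberTheory.LFunctions.sum_primes_inv_sqrt_le`).

## References

* [BalazardDeRoton2008] M. Balazard, A. de Roton, arXiv:0810.3587, Prop. 16.
  [cite: BalazardDeRoton2008, Prop. 16]
* D. A. Goldston, S. M. Gonek, *A note on S(t) and the zeros of the Riemann zeta-function*,
  Bull. London Math. Soc. 39 (2007), 482–486.
-/

noncomputable section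

open Complex Filter Set MeasureTheory Topology Finset Asymptotics
open scoped Real FourierTransform

namespace Literature.NumberTheory.LFunctions

open Literature.Analysis.Fourier ShortIntervalsRH

namespace ShortIntervalsGG

/-- The Dirichlet polynomial of Prop. 15 is trivially `≤ 4 Σ_{p ≤ e^{2πΔ}} p^{-1/2}`.
[cite: BalazardDeRoton2008, Prop. 16 (proof)] -/
theorem abs_primeSum_le {Δ h t : ℝ} (hΔ : 0 < Δ) (hh : 0 ≤ h) :
    |(1 / π) * ∑ p ∈ (Finset.Ioc 0 ⌊Real.exp (2 * π * Δ)⌋₊).filter Nat.Prime,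
        Real.log p / Real.sqrt p *
          (𝓕 (fun x : ℝ ↦ selbergMajorant Δ (-h) h x) (Real.log p / (2 * π))).re * Real.cos (t * Real.log p)| ≤
      4 * ∑ p ∈ (Finset.Ioc 0 ⌊Real.exp (2 * π * Δ)⌋₊).filter Nat.Prime, (1 / Real.sqrt p : ℝ) := by
  rw [Finset.mul_sum, Finset.mul_sum]
  refine (Finset.abs_sum_le_sum_abs _ _).trans (Finset.sum_le_sum fun p hp ↦ ?_)
  rw [Finset.mem_filter] at hp
  have hp2 : 2 ≤ p := hp.2.two_le
  have hp0 : (0 : ℝ) < p := by exact_mod_cast hp.2.pos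
  have h4 := abs_log_mul_re_fourier_selbergMajorant_le hΔ hh hp2
  have hcos : |Real.cos (t * Real.log p)| ≤ 1 := Real.abs_cos_le_one _
  have hsq : 0 < Real.sqrt p := Real.sqrt_pos.2 hp0
  calc |1 / π * (Real.log p / Real.sqrt p *
          (𝓕 (fun x : ℝ ↦ selbergMajorant Δ (-h) h x) (Real.log p / (2 * π))).re * Real.cos (t * Real.log p))|
      = (1 / Real.sqrt p) * (|Real.log p / π *
          (𝓕 (fun x : ℝ ↦ selbergMajorant Δ (-h) h x) (Real.log p / (2 * π))).re| * |Real.cos (t * Real.log p)|) := by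
        rw [← abs_mul, ← abs_of_pos (by positivity : (0 : ℝ) < 1 / Real.sqrt p), ← abs_mul]
        congr 1; field_simp
    _ ≤ (1 / Real.sqrt p) * (4 * 1) := by gcongr
    _ = 4 * (1 / Real.sqrt p) := by ring

/-- The eventual conditions on `a = log t` used in the proof of Prop. 16. [folklore] -/
theorem eventually_conditions (ε K : ℝ) (hε : 0 < ε) :
    ∀ᶠ a : ℝ in atTop, 4 ≤ a ∧ 1 ≤ Real.log a ∧ 1 ≤ Real.log (Real.log a) ∧
      Real.exp (2 * π) * Real.log a ≤ a ∧
      Real.log (Real.log a) ≤ (ε / 4) * Real.log a ∧ 2 * Real.log (Real.log a) ≤ Real.log a ∧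
      1920 ≤ ε * Real.log (Real.log a) ∧ K * Real.log a ^ 2 ≤ ε * a ∧ 8 * Real.log a ≤ ε * a := by
  have hlog : Tendsto Real.log atTop atTop := Real.tendsto_log_atTop
  have hloglog : Tendsto (fun a ↦ Real.log (Real.log a)) atTop atTop := hlog.comp hlog
  have h1 : ∀ᶠ a : ℝ in atTop, 4 ≤ a := eventually_ge_atTop 4
  have h2 : ∀ᶠ a : ℝ in atTop, 1 ≤ Real.log a := hlog.eventually_ge_atTop 1
  have h3 : ∀ᶠ a : ℝ in atTop, 1 ≤ Real.log (Real.log a) := hloglog.eventually_ge_atTop 1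
  have h4 : ∀ᶠ a : ℝ in atTop, Real.exp (2 * π) * Real.log a ≤ a := by
    have ho := Real.isLittleO_log_id_atTop.bound (inv_pos.2 (Real.exp_pos (2 * π)))
    filter_upwards [ho, h1] with a ha ha1
    have hapos : 0 < a := by linarith
    have hlogpos : 0 < Real.log a := Real.log_pos (by linarith)
    rw [Real.norm_eq_abs, Real.norm_eq_abs, abs_of_pos hlogpos, id, abs_of_pos hapos] at ha
    have := mul_le_mul_of_nonneg_left ha (Real.exp_pos (2 * π)).le
    rwa [← mul_assoc, mul_inv_cancel₀ (Real.exp_pos _).ne', one_mul] at this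
  have h5 : ∀ᶠ a : ℝ in atTop, Real.log (Real.log a) ≤ (ε / 4) * Real.log a := by
    have ho := (Real.isLittleO_log_id_atTop.comp_tendsto hlog).bound (by positivity : 0 < ε / 4)
    filter_upwards [ho, h2] with a ha ha2
    simp only [Function.comp, Real.norm_eq_abs, id] at ha
    rw [abs_of_pos (by linarith : 0 < Real.log a)] at ha
    exact (le_abs_self _).trans ha
  have h6 : ∀ᶠ a : ℝ in atTop, 2 * Real.log (Real.log a) ≤ Real.log a := by
    have ho := (Real.isLittleO_log_id_atTop.comp_tendsto hlog).bound (by norm_num : (0 : ℝ) < 1 / 2)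
    filter_upwards [ho, h2] with a ha ha2
    simp only [Function.comp, Real.norm_eq_abs, id] at ha
    rw [abs_of_pos (by linarith : 0 < Real.log a)] at ha
    have := (le_abs_self _).trans ha
    linarith
  have h7 : ∀ᶠ a : ℝ in atTop, 1920 ≤ ε * Real.log (Real.log a) := by
    have := hloglog.eventually_ge_atTop (1920 / ε)
    filter_upwards [this] with a ha
    rw [div_le_iff₀ hε] at ha; linarith
  have h9 : ∀ᶠ a : ℝ in atTop, 8 * Real.log a ≤ ε * a := by
    have ho := Real.isLittleO_log_id_atTop.bound (by positivity : 0 < ε / 8)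
    filter_upwards [ho, h1] with a ha ha1
    rw [Real.norm_eq_abs, Real.norm_eq_abs, id, abs_of_pos (by linarith : (0 : ℝ) < a),
      abs_of_pos (Real.log_pos (by linarith))] at ha
    linarith
  have h8 : ∀ᶠ a : ℝ in atTop, K * Real.log a ^ 2 ≤ ε * a := by
    have ho := (Real.isLittleO_pow_log_id_atTop (n := 2)).bound (by positivity : 0 < ε / (|K| + 1))
    filter_upwards [ho, h1] with a ha ha1
    rw [Real.norm_eq_abs, Real.norm_eq_abs, id, abs_of_pos (by linarith : (0 : ℝ) < a),
      abs_of_nonneg (by positivity)] at ha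
    have hK : K ≤ |K| + 1 := by linarith [le_abs_self K]
    have hpos : 0 ≤ Real.log a ^ 2 := by positivity
    calc K * Real.log a ^ 2 ≤ (|K| + 1) * Real.log a ^ 2 := by gcongr
      _ ≤ (|K| + 1) * (ε / (|K| + 1) * a) := by gcongr
      _ = ε * a := by field_simp
  filter_upwards [h1, h2, h3, h4, h5, h6, h7, h8, h9] with a a1 a2 a3 a4 a5 a6 a7 a8 a9
  exact ⟨a1, a2, a3, a4, a5, a6, a7, a8, a9⟩

end ShortIntervalsGG

open ShortIntervalsGG in
/-- **Balazard–de Roton 2008, Prop. 16 (Goldston–Gonek), upper bound, under RH, uniformly on the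
window `[T − 1, 2T + 1]`**: for every `ε > 0` there is `T₀` such that for `T ≥ T₀`,
`T − 1 ≤ t ≤ 2T + 1` and `0 < h ≤ 1`,
`N(t+h) − N(t−h) − (h/π) log(t/2π) ≤ log T/(2 log log T) + (1/2 + ε) log T · log log log T/(log log T)²`.
(This is the form in which Prop. 16 is used in the proof of Prop. 18.) [cite: BalazardDeRoton2008, Prop. 16] -/
theorem zetaZeroCount_short_interval_GG_uniform_of_RH (hRH : RiemannHypothesis) {ε : ℝ} (hε : 0 < ε) :
    ∃ T₀ : ℝ, ∀ T : ℝ, T₀ ≤ T → ∀ t : ℝ, T - 1 ≤ t → t ≤ 2 * T + 1 → ∀ h : ℝ, 0 < h → h ≤ 1 →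
      ((zetaZeroCount (t + h) : ℝ) - zetaZeroCount (t - h)) - h / π * Real.log (t / (2 * π)) ≤
        Real.log T / (2 * Real.log (Real.log T)) +
          (1 / 2 + ε) * Real.log T * Real.log (Real.log (Real.log T)) / Real.log (Real.log T) ^ 2 := by
  obtain ⟨C_F, hCF⟩ := zetaZeroCount_short_interval_le_of_RH hRH
  obtain ⟨a₀, ha₀⟩ := Filter.eventually_atTop.1 (eventually_conditions ε (4 * |C_F|) hε)
  refine ⟨Real.exp a₀, fun T hT t htl htu h hh0 hh1 ↦ ?_⟩
  -- notation: a = log T, b = log log T, c = log log log T, L = a/b, Δ = (log L)/π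
  have hT0 : 0 < T := (Real.exp_pos a₀).trans_le hT
  set a : ℝ := Real.log T with ha
  have haa₀ : a₀ ≤ a := by rw [ha, ← Real.log_exp a₀]; exact Real.log_le_log (Real.exp_pos _) hT
  obtain ⟨ha4, hb1, hc1, hE2, hE5, hE6, hE7, hE8, hE9⟩ := ha₀ a haa₀
  have hTa : Real.exp a = T := by rw [ha, Real.exp_log hT0]
  have haT : a + 1 ≤ T := by rw [← hTa]; exact Real.add_one_le_exp a
  have ht0 : 0 < t := by linarith only [htl, haT, ha4]
  -- `log t ≤ a + 2`
  have hlogt : Real.log t ≤ a + 2 := by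
    have he2 : (7 : ℝ) ≤ Real.exp 2 := by
      have h1 := Real.exp_one_gt_d9
      have : Real.exp 2 = Real.exp 1 * Real.exp 1 := by rw [← Real.exp_add]; norm_num
      rw [this]; nlinarith only [h1]
    have h3 : t ≤ Real.exp (a + 2) := by
      rw [Real.exp_add, hTa]; nlinarith only [htu, he2, hT0, haT, ha4]
    calc Real.log t ≤ Real.log (Real.exp (a + 2)) := Real.log_le_log ht0 h3
      _ = a + 2 := Real.log_exp _
  set b : ℝ := Real.log a with hb
  set c : ℝ := Real.log b with hc
  have hb0 : 0 < b := by linarith only [hb1]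
  have hc0 : 0 < c := by linarith only [hc1]
  set L : ℝ := a / b with hL
  have hL0 : 0 < L := by positivity
  have hLge : Real.exp (2 * π) ≤ L := by rw [hL, le_div_iff₀ hb0]; exact hE2
  have hlogL : Real.log L = b - c := by rw [hL, Real.log_div (by linarith only [ha4]) hb0.ne']
  have hlogL2π : 2 * π ≤ Real.log L := by
    rw [← Real.log_exp (2 * π)]; exact Real.log_le_log (Real.exp_pos _) hLge
  set Δ : ℝ := Real.log L / π with hΔ
  have hπ := Real.pi_pos
  have hΔ2 : 2 ≤ Δ := by rw [hΔ, le_div_iff₀ hπ]; linarith only [hlogL2π]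
  have hΔ0 : 0 < Δ := by linarith only [hΔ2]
  have hexpπΔ : Real.exp (π * Δ) = L := by
    rw [hΔ, mul_div_cancel₀ _ hπ.ne', Real.exp_log hL0]
  have hexp2πΔ : Real.exp (2 * π * Δ) = L ^ 2 := by
    rw [show 2 * π * Δ = π * Δ + π * Δ by ring, Real.exp_add, hexpπΔ, sq]
  -- `t ≥ 4`, `L ≤ t`
  have ht4 : 4 ≤ t := by linarith only [htl, haT, ha4]
  have hLt : Real.exp (π * Δ) ≤ t := by
    rw [hexpπΔ]
    have hLa : L ≤ a := by
      rw [hL, div_le_iff₀ hb0]; nlinarith only [hb1, ha4]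
    linarith only [hLa, haT, htl]
  have ha0 : 0 < a := by linarith only [ha4]
  have hbc : b / 2 ≤ b - c := by linarith only [hE6]
  have hbc0 : 0 < b - c := by linarith only [hbc, hb0]
  have hX2 : (2 : ℝ) ≤ L ^ 2 := by
    have : Real.exp (2 * π) ≥ 2 := by
      linarith [Real.add_one_le_exp (2 * π), Real.pi_gt_three]
    nlinarith only [this, hLge]
  have hsqL : Real.sqrt (L ^ 2) = L := Real.sqrt_sq hL0.le
  have hlogL2 : Real.log (L ^ 2) = 2 * (b - c) := by rw [Real.log_pow, hlogL]; push_cast; ring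
  -- the `C log Δ` term: `log Δ ≤ log log L ≤ log b = c`
  have hlogΔ : C_F * Real.log Δ ≤ |C_F| * c := by
    have hΔle : Δ ≤ b := by
      rw [hΔ, div_le_iff₀ hπ, hlogL]
      nlinarith only [Real.pi_gt_three, hb0, hc0]
    have hlogΔ0 : 0 ≤ Real.log Δ := Real.log_nonneg (by linarith only [hΔ2])
    have hlogΔc : Real.log Δ ≤ c := by rw [hc]; exact Real.log_le_log hΔ0 hΔle
    calc C_F * Real.log Δ ≤ |C_F| * Real.log Δ := by gcongr; exact le_abs_self _
      _ ≤ |C_F| * c := by gcongr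
  -- the main term: `a/(2πΔ) = a/(2(b−c)) ≤ a/(2b) + ac/(2b²) + ac²/b³`
  have hmain : a / (2 * π * Δ) = a / (2 * (b - c)) := by
    rw [hΔ, hlogL]; field_simp
  have hmain_le : a / (2 * (b - c)) ≤ a / (2 * b) + a * c / (2 * b ^ 2) + a * c ^ 2 / b ^ 3 := by
    have hbne : b ≠ 0 := hb0.ne'
    have hbcne : b - c ≠ 0 := hbc0.ne'
    have hid : 1 / (2 * b) + c / (2 * b ^ 2) + c ^ 2 / b ^ 3 - 1 / (2 * (b - c)) =
        c ^ 2 * (b - 2 * c) / (2 * b ^ 3 * (b - c)) := by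
      field_simp
      ring
    have hnn : 0 ≤ c ^ 2 * (b - 2 * c) / (2 * b ^ 3 * (b - c)) :=
      div_nonneg (mul_nonneg (sq_nonneg _) (by linarith only [hE6])) (by positivity)
    have hkey : 1 / (2 * (b - c)) ≤ 1 / (2 * b) + c / (2 * b ^ 2) + c ^ 2 / b ^ 3 := by linarith only [hid, hnn]
    have := mul_le_mul_of_nonneg_left hkey ha0.le
    calc a / (2 * (b - c)) = a * (1 / (2 * (b - c))) := by ring
      _ ≤ a * (1 / (2 * b) + c / (2 * b ^ 2) + c ^ 2 / b ^ 3) := this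
      _ = a / (2 * b) + a * c / (2 * b ^ 2) + a * c ^ 2 / b ^ 3 := by ring
  -- the four small terms are each `≤ (ε/4) a c / b²`
  have hs1 : a * c ^ 2 / b ^ 3 ≤ (ε / 4) * (a * c / b ^ 2) := by
    rw [div_le_iff₀ (by positivity)]
    calc a * c ^ 2 = (a * c) * c := by ring
      _ ≤ (a * c) * ((ε / 4) * b) := by gcongr
      _ = (ε / 4) * (a * c / b ^ 2) * b ^ 3 := by field_simp
  have hs2 : 480 * a / b ^ 2 ≤ (ε / 4) * (a * c / b ^ 2) := by
    rw [show (ε / 4) * (a * c / b ^ 2) = (ε * c / 4) * a / b ^ 2 by ring]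
    rw [div_le_div_iff_of_pos_right (by positivity)]
    have h480 : (480 : ℝ) ≤ ε * c / 4 := by linarith only [hE7]
    exact mul_le_mul_of_nonneg_right h480 ha0.le
  have hs3 : |C_F| * c ≤ (ε / 4) * (a * c / b ^ 2) := by
    rw [show (ε / 4) * (a * c / b ^ 2) = (ε * a / (4 * b ^ 2)) * c by ring]
    refine mul_le_mul_of_nonneg_right ?_ hc0.le
    rw [le_div_iff₀ (by positivity)]
    linarith only [hE8]
  have hs4 : 2 / (2 * (b - c)) ≤ (ε / 4) * (a * c / b ^ 2) := by
    have h1 : 2 / (2 * (b - c)) ≤ 2 / b := by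
      rw [div_le_div_iff₀ (by positivity) hb0]; linarith only [hE6]
    have h2 : 2 / b ≤ (ε / 4) * (a * c / b ^ 2) := by
      rw [show (ε / 4) * (a * c / b ^ 2) = (ε * a * c / (4 * b)) / b by field_simp,
        div_le_div_iff_of_pos_right hb0, le_div_iff₀ (by positivity)]
      have : ε * a ≤ ε * a * c := le_mul_of_one_le_right (by positivity) hc1
      linarith only [this, hE9]
    exact h1.trans h2
  have hfinal : (a + 2) / (2 * (b - c)) + 480 * a / b ^ 2 + |C_F| * c ≤
      a / (2 * b) + (1 / 2 + ε) * a * c / b ^ 2 := by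
    have : (1 / 2 + ε) * a * c / b ^ 2 = a * c / (2 * b ^ 2) + 4 * ((ε / 4) * (a * c / b ^ 2)) := by
      field_simp
    rw [this, add_div]; linarith only [hmain_le, hs1, hs2, hs3, hs4]
  have hhπ : 2 * h * Real.log (t / (2 * π)) / (2 * π) = h / π * Real.log (t / (2 * π)) := by
    field_simp
  -- Chebyshev for the Dirichlet polynomial: `4 Σ_{p ≤ L²} p^{-1/2} ≤ 480 a / b²`
  have hcheb := sum_primes_inv_sqrt_le hX2
  rw [hsqL, hlogL2] at hcheb
  have hpoly : 4 * ∑ p ∈ (Finset.Ioc 0 ⌊L ^ 2⌋₊).filter Nat.Prime, (1 / Real.sqrt p : ℝ) ≤ 480 * a / b ^ 2 := by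
    calc 4 * ∑ p ∈ (Finset.Ioc 0 ⌊L ^ 2⌋₊).filter Nat.Prime, (1 / Real.sqrt p : ℝ)
        ≤ 4 * (60 * L / (2 * (b - c))) := by gcongr
      _ = 120 * (a / b) / (b - c) := by rw [hL]; field_simp; ring
      _ ≤ 120 * (a / b) / (b / 2) := by gcongr
      _ = 240 * a / b ^ 2 := by field_simp; ring
      _ ≤ 480 * a / b ^ 2 := by
          rw [div_le_div_iff_of_pos_right (by positivity)]; linarith only [ha0]
  have hmain_t : Real.log t / (2 * π * Δ) ≤ (a + 2) / (2 * (b - c)) := by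
    rw [show 2 * π * Δ = 2 * (b - c) by rw [hΔ, hlogL]; field_simp]
    exact div_le_div_of_nonneg_right hlogt (by positivity)
  -- Prop. 15 (introduced last: keeps `linarith`'s context small)
  have h15 := hCF t Δ h ht4 hΔ2 hLt hh0 hh1
  have hprime := abs_primeSum_le (t := t) hΔ0 hh0.le
  rw [hexp2πΔ] at hprime h15
  rw [hhπ] at h15
  have habs := (abs_le.1 hprime).1
  linarith only [h15, habs, hpoly, hfinal, hlogΔ, hmain_t]

open ShortIntervalsGG in
/-- **Balazard–de Roton 2008, Prop. 16 (Goldston–Gonek), upper bound, under RH**: for every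
`ε > 0` there is `T₀` such that for `t ≥ T₀` and `0 < h ≤ 1`,
`N(t+h) − N(t−h) − (h/π) log(t/2π) ≤ log t/(2 log log t) + (1/2 + ε) log t · log log log t/(log log t)²`.
[cite: BalazardDeRoton2008, Prop. 16] -/
theorem zetaZeroCount_short_interval_GG_of_RH (hRH : RiemannHypothesis) {ε : ℝ} (hε : 0 < ε) :
    ∃ T₀ : ℝ, ∀ t : ℝ, T₀ ≤ t → ∀ h : ℝ, 0 < h → h ≤ 1 →
      ((zetaZeroCount (t + h) : ℝ) - zetaZeroCount (t - h)) - h / π * Real.log (t / (2 * π)) ≤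
        Real.log t / (2 * Real.log (Real.log t)) +
          (1 / 2 + ε) * Real.log t * Real.log (Real.log (Real.log t)) / Real.log (Real.log t) ^ 2 := by
  obtain ⟨T₀, hT₀⟩ := zetaZeroCount_short_interval_GG_uniform_of_RH hRH hε
  refine ⟨max T₀ 0, fun t ht h hh0 hh1 ↦ hT₀ t ((le_max_left _ _).trans ht) t (by linarith) ?_ h hh0 hh1⟩
  linarith [(le_max_right T₀ 0).trans ht]

end Literature.NumberTheory.LFunctions
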